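import Mathlib.RingTheory.Localization.FractionRing
import Mathlib.RingTheory.Polynomial.Basic
import Literature.Computability.AlgebraicComplexity.MatMulRankLowerBoundsProofs
import Literature.Computability.AlgebraicComplexity.SchoenhageTauBini
import Literature.Computability.AlgebraicComplexity.BorderRankRestriction
import HarnessLib

/-!
# Koszul flattenings bound the BORDER rank (Landsberg–Ottaviani 2015, Thm. 2.1) — proved

Topic: `Literature/Computability/AlgebraicComplexity`. `MatMulRankLowerBoundsProofs.lean` proves the
rank form of the Koszul-flattening bound, `rank K_Φ(t) ≤ binom(2p,p) · R(t)`
(`LandsbergOttaviani2015_rank_koszulFlattening_le`, any field, `dim A' = 2p + 1`). Landsberg and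
Ottaviani state the bound for the border rank (LO2015, Thm. 2.1: "`R̲(T) ≥ rank T_A^{∧p} / binom(a−1,p)`",
proof: "`rank T_A^{∧p} ≤ rank (T_ε)_A^{∧p} ≤ ∑ᵢ rank (T_{ε,i})_A^{∧p} = r binom(a−1,p)`"), and this is
the form in which it is used for all the lower bounds of Conner–Gesmundo–Landsberg–Ventura 2022
(§3, eq. (8), quoting [LO13, Prop. 4.1.1]). This file proves the border-rank form for the tree's
ALGEBRAIC border rank `algBorderRank` (Bläser 2013, Def. 6.1, approximate decompositions over
`L[ε]`), over an arbitrary field `L`: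

* `koszulFlattening_map` — Koszul flattenings commute with ring homomorphisms applied entrywise
  (to the tensor and to the matrix of `Φ`).
* `Matrix.exists_isUnit_det_submatrix_of_rank` — a matrix of rank `k` over a field has a `k × k`
  submatrix with non-zero determinant (extract independent columns, then independent rows).
* `rank_map_constantCoeff_le` — for a polynomial matrix `N(ε)`, `rank_L N(0) ≤ rank_{L(ε)} N(ε)`
  (a non-zero minor of `N(0)` is the constant term of the same minor of `N(ε)`).
* `LandsbergOttaviani2015_thm21_algBorderRank` — **`rank K_Φ(t) ≤ binom(2p,p) · bR(t)`**
  (linear `Φ`; an independent proof of the matrix form, by clearing denominators instead of minors,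
  landed concurrently as `KoszulFlatteningBorderRank.rank_koszulFlattening_le_choose_mul_algBorderRank`):
  take an optimal order-`h` approximate decomposition `∑_ρ u_ρ ⊗ v_ρ ⊗ w_ρ = ε^h (t + ε t')` over
  `L[ε]`; over the field `L(ε)` the tensor `t + ε t' = ε^{-h} ∑_ρ …` has rank `≤ bR(t)`, so by the
  rank form `rank_{L(ε)} K_Φ(t + ε t') ≤ binom(2p,p) bR(t)`, while `rank_L K_Φ(t) ≤ rank_{L(ε)} K_Φ(t + εt')`.

## References

* J. M. Landsberg, G. Ottaviani, *New lower bounds for the border rank of matrix multiplication*,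
  Theory of Computing 11 (2015) 285–298, arXiv:1112.6007, Thm. 2.1 and its proof (held:
  `paper:arxiv-1112.6007`, chunk 5). [LandsbergOttaviani2015]
* A. Conner, F. Gesmundo, J. M. Landsberg, E. Ventura, comput. complexity 31 (2022) =
  arXiv:1909.04785v2, §3, eq. (8). [ConnerGesmundoLandsbergVentura2022]
* M. Bläser, *Fast Matrix Multiplication*, Theory of Computing Graduate Surveys 5 (2013), Def. 6.1.
-/

noncomputable section

open scoped BigOperators Polynomial

namespace Literature.Computability.AlgebraicComplexity

universe u v w

/-! ## Koszul flattenings under ring homomorphisms -/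

/-- Koszul flattenings commute with a ring homomorphism `g` applied to the tensor and to the matrix
of the restriction map `Φ`: `g(K_{M}(t)) = K_{g(M)}(g ∘ t)`. [folklore] -/
theorem koszulFlattening_map {K K' : Type*} [CommRing K] [CommRing K'] (g : K →+* K') (p : ℕ)
    {ι κ μ : Type*} [Fintype ι] (M : Matrix (Fin (2 * p + 1)) ι K) (t : ι → κ → μ → K) :
    (koszulFlattening p M.mulVecLin t).map g =
      koszulFlattening p (M.map g).mulVecLin (fun a b c => g (t a b c)) := by
  ext r c
  simp only [Matrix.map_apply, koszulFlattening_apply, Matrix.mulVecLin_apply]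
  rw [wedgeMatrix_map]
  congr 1
  funext i
  exact RingHom.map_mulVec g M _ i

/-! ## Minors: a rank-`k` matrix has an invertible `k × k` submatrix -/

/-- Over a field, a matrix of rank `k` has a `k × k` submatrix with invertible determinant
(choose `k` independent columns, then `k` independent rows of those). [folklore] -/
theorem Matrix.exists_isUnit_det_submatrix_of_rank {L : Type*} [Field L] {R C : Type*} [Fintype R]
    [Fintype C] [DecidableEq R] [DecidableEq C] (M : Matrix R C L) :
    ∃ (r : Fin M.rank → R) (c : Fin M.rank → C), IsUnit (M.submatrix r c).det := by
  classical
  -- independent columns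
  obtain ⟨κ₁, a, ha, hspan₁, hli₁⟩ := exists_linearIndependent' L M.col
  haveI : Fintype κ₁ := Fintype.ofInjective a ha
  have hcard₁ : Fintype.card κ₁ = M.rank := by
    rw [Matrix.rank_eq_finrank_span_cols, ← hspan₁, finrank_span_eq_card hli₁]
  set B : Matrix R κ₁ L := M.submatrix id a with hB
  have hBcol : B.col = M.col ∘ a := rfl
  have hBrank : B.rank = Fintype.card κ₁ := by
    rw [Matrix.rank_eq_finrank_span_cols, hBcol, finrank_span_eq_card hli₁]
  -- independent rows of `B`
  obtain ⟨κ₂, b, hb, hspan₂, hli₂⟩ := exists_linearIndependent' L B.row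
  haveI : Fintype κ₂ := Fintype.ofInjective b hb
  have hcard₂ : Fintype.card κ₂ = Fintype.card κ₁ := by
    rw [← hBrank, Matrix.rank_eq_finrank_span_row, ← hspan₂, finrank_span_eq_card hli₂]
  set e : κ₂ ≃ κ₁ := Fintype.equivOfCardEq hcard₂
  set e₁ : Fin M.rank ≃ κ₁ := Fintype.equivFinOfCardEq hcard₁ |>.symm
  -- the square submatrix on rows `b ∘ e.symm`, columns `a`, reindexed by `Fin M.rank`
  refine ⟨b ∘ e.symm ∘ e₁, a ∘ e₁, ?_⟩
  have hrows : LinearIndependent L (M.submatrix (b ∘ e.symm ∘ e₁) (a ∘ e₁)).row := by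
    have h2 : LinearIndependent L (B.row ∘ b ∘ e.symm ∘ e₁) :=
      (hli₂.comp (e.symm ∘ e₁) (e.symm.injective.comp e₁.injective))
    -- rows of the submatrix are the rows `B (b (e.symm (e₁ i)))` precomposed with `e₁`
    have h3 : (M.submatrix (b ∘ e.symm ∘ e₁) (a ∘ e₁)).row =
        (fun v : κ₁ → L => v ∘ e₁) ∘ (B.row ∘ b ∘ e.symm ∘ e₁) := by
      funext i j
      rfl
    rw [h3]
    exact h2.map' (LinearMap.funLeft L L e₁)
      (LinearMap.ker_eq_bot_of_injective (LinearMap.funLeft_injective_of_surjective _ _ _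
        e₁.surjective))
  exact (Matrix.isUnit_iff_isUnit_det _).1 (Matrix.linearIndependent_rows_iff_isUnit.1 hrows)

/-- A non-zero minor certifies rank: if some `k × k` submatrix has invertible determinant then
`k ≤ rank`. [folklore] -/
theorem Matrix.le_rank_of_isUnit_det_submatrix {L : Type*} [Field L] {R C : Type*} [Fintype R]
    [Fintype C] {k : ℕ} (M : Matrix R C L) (r : Fin k → R) (c : Fin k → C)
    (h : IsUnit (M.submatrix r c).det) : k ≤ M.rank := by
  have h1 : (M.submatrix r c).rank = k := by
    rw [Matrix.rank_of_isUnit _ ((Matrix.isUnit_iff_isUnit_det _).2 h), Fintype.card_fin]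
  rw [← h1]
  exact Matrix.rank_submatrix_le M r c

/-! ## Polynomial matrices: the rank at `ε = 0` is at most the rank over `L(ε)` -/

/-- For a matrix `N(ε)` with entries in `L[ε]`, `rank_L N(0) ≤ rank_{L(ε)} N(ε)`: a non-zero
`k`-minor of `N(0)` is the constant term of the corresponding minor of `N(ε)`, which is then a
non-zero element of the field of fractions `L(ε)`. [folklore] -/
theorem rank_map_constantCoeff_le {L : Type*} [Field L] {R C : Type*} [Fintype R] [Fintype C]
    [DecidableEq R] [DecidableEq C] (N : Matrix R C L[X]) :
    (N.map Polynomial.constantCoeff).rank ≤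
      (N.map (algebraMap L[X] (FractionRing L[X]))).rank := by
  obtain ⟨r, c, hU⟩ := Matrix.exists_isUnit_det_submatrix_of_rank (N.map Polynomial.constantCoeff)
  refine Matrix.le_rank_of_isUnit_det_submatrix _ r c ?_
  -- the minor `D = det N[r, c] ∈ L[X]` has non-zero constant term, hence is non-zero in `L(X)`
  set D : L[X] := (N.submatrix r c).det with hD
  have h0 : Polynomial.constantCoeff D = ((N.map Polynomial.constantCoeff).submatrix r c).det := by
    rw [hD, RingHom.map_det, RingHom.mapMatrix_apply]
    rfl
  have hD0 : D ≠ 0 := by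
    intro hzero
    apply hU.ne_zero
    rw [← h0, hzero, map_zero]
  have hF : algebraMap L[X] (FractionRing L[X]) D =
      ((N.map (algebraMap L[X] (FractionRing L[X]))).submatrix r c).det := by
    rw [hD, RingHom.map_det, RingHom.mapMatrix_apply]
    rfl
  rw [← hF]
  exact isUnit_iff_ne_zero.2
    (fun h => hD0 (IsFractionRing.injective L[X] (FractionRing L[X]) (by rw [h, map_zero])))

/-! ## The border-rank form of the Koszul bound -/

/-- **Landsberg–Ottaviani 2015, Thm. 2.1, for the algebraic border rank** (`dim A' = 2p + 1`, any
field `L`; CGLV 2022, §3, eq. (8)): for every tensor `t ∈ L^ι ⊗ L^κ ⊗ L^μ` and every linear map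
`Φ : L^ι → L^{2p+1}`, `rank K_Φ(t) ≤ binom(2p, p) · bR(t)`, i.e. `bR(t) ≥ rank K_Φ(t) / binom(2p,p)`.
Proof as printed ("`rank T_A^{∧p} ≤ rank (T_ε)_A^{∧p} ≤ r binom(a−1,p)`"), with `T_ε` an optimal
approximate decomposition over `L[ε]`, its rank counted over the field `L(ε)`.
[cite: LandsbergOttaviani2015, Thm 2.1] -/
theorem LandsbergOttaviani2015_thm21_algBorderRank {L : Type u} [Field L] (p : ℕ)
    {ι : Type v} {κ μ : Type w} [Fintype ι] [Fintype κ] [Fintype μ] [DecidableEq ι] [DecidableEq κ]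
    [DecidableEq μ] (Φ : (ι → L) →ₗ[L] (Fin (2 * p + 1) → L)) (t : ι → κ → μ → L) :
    (koszulFlattening p Φ t).rank ≤ (2 * p).choose p * algBorderRank t := by
  classical
  -- an optimal approximate decomposition: order `h`, `bR(t) = R_h(t)` triads over `L[X]`
  obtain ⟨h, hh⟩ := exists_algBorderRank_eq_approxRank t
  obtain ⟨u, v, w, huvw⟩ := exists_isApproxDecomposition_approxRank h t
  -- entrywise `∑_ρ u v w = X^h · Q` with `Q(0) = t` (`isApproxDecomposition_iff`)
  choose Q hQ hQ0 using isApproxDecomposition_iff.1 huvw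
  -- the field of fractions `F = L(X)` and the base-changed data
  let F := FractionRing L[X]
  let f : L[X] →+* F := algebraMap L[X] F
  have hf : Function.Injective f := IsFractionRing.injective L[X] F
  let QF : ι → κ → μ → F := fun a b c => f (Q a b c)
  let MΦ : Matrix (Fin (2 * p + 1)) ι L := LinearMap.toMatrix' Φ
  have hMΦ : MΦ.mulVecLin = Φ := by
    refine LinearMap.ext fun x => ?_
    rw [Matrix.mulVecLin_apply, ← Matrix.toLin'_apply, Matrix.toLin'_toMatrix']
  let MX : Matrix (Fin (2 * p + 1)) ι L[X] := MΦ.map Polynomial.C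
  -- (1) `K_Φ(t) = K_{MX}(Q)` at `X = 0`
  have h1 : koszulFlattening p Φ t =
      (koszulFlattening p MX.mulVecLin Q).map Polynomial.constantCoeff := by
    rw [koszulFlattening_map, Matrix.map_map]
    have hM : MΦ.map (⇑Polynomial.constantCoeff ∘ ⇑Polynomial.C) = MΦ := by
      ext i j
      simp
    have ht : (fun a b c => Polynomial.constantCoeff (Q a b c)) = t := by
      funext a b c
      rw [Polynomial.constantCoeff_apply, hQ0]
    rw [hM, ht, hMΦ]
  -- (2) over `F`: `K_{MX}(Q)` mapped to `F` is `K_{MF}(QF)`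
  have h2 : (koszulFlattening p MX.mulVecLin Q).map f =
      koszulFlattening p (MX.map f).mulVecLin QF := koszulFlattening_map f p MX Q
  -- (3) `R_F(QF) ≤ R_h(t)`: `QF = (f X)^{-h} ∑_ρ (f u_ρ) ⊗ (f v_ρ) ⊗ (f w_ρ)`
  have hX : f Polynomial.X ≠ 0 := fun h0 => Polynomial.X_ne_zero (hf (by rw [h0, map_zero]))
  have h3 : tensorRank QF ≤ approxRank h t := by
    refine tensorRank_le_of_eq_sum (fun ρ a => (f Polynomial.X ^ h)⁻¹ * f (u ρ a))
      (fun ρ b => f (v ρ b)) (fun ρ c => f (w ρ c)) ?_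
    funext a b c
    rw [Finset.sum_apply, Finset.sum_apply, Finset.sum_apply]
    simp only [triad_apply]
    have hsum : (∑ ρ, (f Polynomial.X ^ h)⁻¹ * f (u ρ a) * f (v ρ b) * f (w ρ c)) =
        (f Polynomial.X ^ h)⁻¹ * f (∑ ρ, u ρ a * v ρ b * w ρ c) := by
      rw [map_sum, Finset.mul_sum]
      exact Finset.sum_congr rfl fun ρ _ => by rw [map_mul, map_mul]; ring
    rw [hsum, hQ, map_mul, map_pow, ← mul_assoc, inv_mul_cancel₀ (pow_ne_zero h hX), one_mul]
  -- (4) assemble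
  calc (koszulFlattening p Φ t).rank
      = ((koszulFlattening p MX.mulVecLin Q).map Polynomial.constantCoeff).rank := by rw [h1]
    _ ≤ ((koszulFlattening p MX.mulVecLin Q).map f).rank := rank_map_constantCoeff_le _
    _ = (koszulFlattening p (MX.map f).mulVecLin QF).rank := by rw [h2]
    _ ≤ (2 * p).choose p * tensorRank QF :=
        LandsbergOttaviani2015_rank_koszulFlattening_le p _ QF
    _ ≤ (2 * p).choose p * approxRank h t := Nat.mul_le_mul_left _ h3
    _ = (2 * p).choose p * algBorderRank t := by rw [hh]

/-- The bound in quotient form: `⌈rank K_Φ(t) / binom(2p,p)⌉ ≤ bR(t)`.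
[cite: LandsbergOttaviani2015, Thm 2.1] -/
theorem LandsbergOttaviani2015_thm21_algBorderRank_div {L : Type u} [Field L] (p : ℕ)
    {ι : Type v} {κ μ : Type w} [Fintype ι] [Fintype κ] [Fintype μ] [DecidableEq ι] [DecidableEq κ]
    [DecidableEq μ] (Φ : (ι → L) →ₗ[L] (Fin (2 * p + 1) → L)) (t : ι → κ → μ → L) :
    ((koszulFlattening p Φ t).rank + (2 * p).choose p - 1) / (2 * p).choose p ≤ algBorderRank t := by
  have hpos : 0 < (2 * p).choose p := Nat.choose_pos (by omega)
  have h' := Nat.add_le_add_right (LandsbergOttaviani2015_thm21_algBorderRank p Φ t)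
    ((2 * p).choose p - 1)
  refine (Nat.div_le_iff_le_mul_add_pred hpos).2 ?_
  calc (koszulFlattening p Φ t).rank + (2 * p).choose p - 1
      = (koszulFlattening p Φ t).rank + ((2 * p).choose p - 1) := by omega
    _ ≤ (2 * p).choose p * algBorderRank t + ((2 * p).choose p - 1) := h'

end Literature.Computability.AlgebraicComplexity

end
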